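import Mathlib
import HarnessLib
import HarnessLib.Audit
import Summits.ValiantsHypothesis.Statement
import Literature.Computability.AlgebraicComplexity.ValiantConjectureProofs
import HarnessLib.Audit.Status.Attr

/-!
Route: FermionizationDimension

DORMANT since 2026-08-23T17:54:13Z (reconciler: no traction for 6.2 d (last activity item-evidence-added at 2026-08-17T13:32:49Z); parked, not closed — `ledger route dormant route-ValiantsHypothesis-FermionizationDimension --off` to rea) — unstaffed, not closed; items shared with open routes are served there. `ledger route dormant <id> --off` reactivates.

# Route FermionizationDimension — nilpotent-twisted determinants — the permanent needs a large
commutative coefficient algebra, VP class functions do not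

COMMUTATIVE TWISTING ("fermionization") DIMENSION. For a coefficient pattern c : S_n → ℂ let s(c) be
the least dim_ℂ R over
commutative finite-dimensional ℂ-algebras R, matrices u ∈ R^{n×n} and linear functionals ℓ : R → ℂ
with ℓ(∏_i u_{σ(i),i}) = sgn(σ)·c(σ)
for all σ ∈ S_n — exactly the data making Σ_σ c(σ)x^σ = ℓ(det_R((x_ij u_ij))) coefficientwise, a
linear image of ONE n×n determinant
whose entries are twisted by R (support TwistedDeterminantFormula); s(n) := s(1) is the permanent's,
and 2 ≤ s(n) ≤ C(2n,n) for n ≥ 3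
(Pólya–Szegő–Marcus–Minc; the even Grassmann algebra generated by the α_iβ_j, which is the apolar
algebra of det_n).
It suffices to show X = X1 ∧ X2. X1 = SDimPerNotQP: s(n) is not quasi-polynomially bounded
(conjecture: 2^{Θ(n)}). X2 = ClassTransfer:
for every p-family of CLASS FUNCTIONS χ_n : S_n → ℂ with (d_{χ_n})_n ∈ VP_ℂ, s(χ_n) is
quasi-polynomially bounded. Realises card
fermionization-dimension (X1 = its C1 with the apolarity/Hilbert-scheme engine; X2 = its transfer
(B_s) restricted to Schur's slice of
class functions, a restriction forced by the Pfaffian escape recorded under Why this line).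
Lean: `SDimPerNotQP ∧ ClassTransfer`

## Assembly
Pure logic over proved tree facts (checked sorry-free in the planner's Sketch.lean): if VP ℂ = VNP ℂ
then per is p-computable
(`Literature.Computability.AlgebraicComplexity.isPComputable_perPoly_complex_iff`, proved) and with
`isPFamily_perPoly_holds` the family
`fun n => perPoly (Fin n) ℂ` is a VP family; it is literally the class-function GMF family with χ ≡
1 (`simp [perPoly, Matrix.permanent,
Matrix.mvPolynomialX]`), so ClassTransfer yields a quasi-polynomially bounded s with realisations
ℓ(∏ u_{σ(i),i}) = sgn σ · 1 of dimension
≤ s(n) for every n, contradicting SDimPerNotQP at its witness n. Hence VP ℂ ≠ VNP ℂ =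
`ValiantsHypothesis` (equivalently via
`Summit.ValiantsHypothesis.Hub.valiantsHypothesis_of_not_isVPFamily_per`).

Rationale: WHY THIS LINE. Every easy evaluation of a permanent-like sum runs a determinant (or Pfaffian) over a
COMMUTATIVE coefficient ring — over a noncommutative
algebra of polynomial dimension the determinant itself is permanent-hard (ArvindSrinivasan2010,
Bläser/CHSS dichotomy), and a
commutative extension never lowers complexity (HrubesYehudayoff2011 Thm 3.4) while costing only
dim(R)^3 per operation (Thm 4.2) — so the one
currency left is the dimension of a commutative Artinian algebra whose nilpotents fake the sign
character: s(n). It is VH-necessary in the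
sharp sense SimulationCost: a realisation of dimension s gives L(per_n) ≤ (n+s+2)^c, hence VP ≠ VNP
⇒ s(n) → ∞ (crux SDimUnbounded) and
VNP ⊄ VQP ⇒ SDimPerNotQP; nothing beyond s(n) ≥ 2 (MarcusMinc1961; BrualdiRyser1991 Thm 7.5.1) is
known, against the
Grassmann point C(2n,n) and the semisimple (sums of Hadamard-twisted determinants, card
twisted-determinantal-rank) ceiling n^{O(n)}.
Imported area: apolarity / finite schemes — by Macaulay duality s(n) is the least colength of an
ideal I ⊂ ℂ[u_ij] whose transversal part
lies in ker(sgn), i.e. the length of the cheapest scheme apolar to det_n + (non-transversal junk);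
without junk Ranestad–Schreyer
(RanestadSchreyer2011, Landsberg2017 Thm 10.1.4.1) with Shafiei2015 (Ann(det_n) generated by
quadrics, Hilbert function
C(n,k)²) already give length ≥ ½·C(2n,n); the engine for X1 is to control the junk by Hankel
consistency across degrees, socle degree and
smoothability (IarrobinoKanev1999, BuczynskaBuczynski2021), information that single flattenings
cannot see.
Sufficiency needs a transfer statement, and here the route CORRECTS both sibling cards: the
unrestricted transfer "(B): every VP family
supported on permutation monomials has quasi-polynomial twisting rank/dimension" is dead on arrival
— g_n := Pf((x_ij x_ji)_{i<j}) =
Σ_{σ fixed-point-free involution} ε(M(σ)) x^σ is in VP, and a commutative realisation (R,u,ℓ) of its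
pattern of dimension s gives
Hf_n(Y) = ±ℓ(Pf_R((y_ij u_ij u_ji))), a Pfaffian over a commutative ring (division-free, poly(n)
ring operations: Rote2001,
MahajanVinay1997), so (B) ⇒ per_m = Hf_2m(bipartite) ∈ VQP. ε(M(σ)) is NOT a class function, and
every class function known to be
VP-cheap — the cone sgn·F(c_1)·P(c_2,…,c_k) + (bounded support) of Hartmann1985,
Burgisser2000Immanants, MertensMoore2013, and the easy
side b(λ) = O(1) of Curticapean2021's immanant dichotomy via character polynomials — has POLYNOMIAL
s by explicit nilpotent counting algebras
(ℂ[ε]/(ε^{n+1}) with u = J + εI for F(c_1); the truncated algebra ℂ[η_ab]/(monomials of degree > D),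
dim O(n^{2D}), with u_ab = 1 + η_ab
realises every pattern of junta-degree ≤ D — all bounded-degree polynomials in c_2,…,c_k — and with
u_aa = 1, u_ab = η_ab every pattern
supported on permutations moving ≤ D points; sums and products of patterns cost sums and products of
dimensions).
Hence X2 lives on the same slice as route ImmanantSlice's cuspidal rigidity CR but is logically
independent of it (CR constrains VALUES on
long cycles, X2 the multiplicative-nilpotent STRUCTURE of the whole pattern) and needs X1 as its
partner; negatives index empty at filing.

RANKED CRUXES. #2 SDimPerNotQP (crux) — the commutative twisting dimension of the permanent is not
quasi-polynomially bounded: for every quasi-polynomially bounded s there is an n such that no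
commutative ℂ-algebra R with dim R ≤ s(n), u ∈ R^{n×n}, ℓ ∈ R^* satisfy ℓ(∏_i u_{σ(i),i}) = sgn σ
for all σ ∈ S_n (card C1, "det_n is junk-incompressible"; conjectured truth 2^{Θ(n)}, possibly
C(2n,n)). [difficulty: open-problem] (why it might fail: false only if VNP ⊆ VQP (SimulationCost);
the risk is technique: junk (several fat points) fools every single catalecticant, complex twists
already give tdr(per_3)=2, tdr(per_4)=3, and no min-over-completions cactus bound exists yet.)
[MarcusMinc1961, BrualdiRyser1991, RanestadSchreyer2011, Shafiei2015, IarrobinoKanev1999,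
BuczynskaBuczynski2021, Landsberg2017, Tesler2000]
#3 ClassTransfer (crux) — fermionic normal form on Schur's slice: for every family of class
functions χ_n : S_n → ℂ whose generalized matrix functions d_{χ_n} = Σ_σ χ_n(σ) ∏_i x_{σ(i),i} form
a VP family over ℂ, there is a quasi-polynomially bounded s such that for every n some commutative
ℂ-algebra R of dimension ≤ s(n), u ∈ R^{n×n}, ℓ ∈ R^* realise ℓ(∏_i u_{σ(i),i}) = sgn(σ)·χ_n(σ) ("a
polynomial-size circuit for a class-function amplitude is one determinant over a small commutative
world of nilpotents"; card (B_s), restricted to class functions). [difficulty: open-problem] (why it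
might fail: a VP class-function family whose cheapness comes from Pfaffian-type or cross-determinant
cancellation (suspects: sgn·t^{c_2(σ)}, the 2-cycle-free determinant, D^even = Σ_{all cycles even}
sgn x^σ if any is in VP) would have exponential s, exactly as Pf(x_ij x_ji) kills the unrestricted
form.) [Curticapean2021, Burgisser2000Immanants, Hartmann1985, MertensMoore2013, Tesler2000,
LoeblMasbaum2011, Rote2001, HrubesYehudayoff2011]
#4 SDimUnbounded (crux) — s(n) → ∞: for every s₀ and all large n, no commutative ℂ-algebra of
dimension ≤ s₀ realises the sign character of S_n multiplicatively (first milestone past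
Marcus–Minc's s(n) ≥ 2; the first rung s(n) ≥ 3 for n ≥ 5 is, by the classification of 2-dimensional
algebras ℂ², ℂ[ε]/ε², the conjunction of "no two Hadamard-twisted determinants sum to per_n" and "no
dual-number representation per_n = c·det B(x) + tr(adj B(x)·L(x)) with B, L Hadamard scalings of
x"). [difficulty: L] (why it might fail: false only if per ∈ VP (bounded s + SimulationCost +
monotonicity of s in n); the risk is that even dimension 2 resists: tdr(per_n) ≥ 3 is only numerical
(n = 4, 5) and linear-preserver arguments over local rings (dual numbers) are untried.)
[MarcusMinc1961, BrualdiRyser1991, Tesler2000, LoeblMasbaum2011, HrubesYehudayoff2011]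
#9 TwistedDeterminantFormula (support) — semantics of the model: if ℓ(∏_i u_{σ(i),i}) = sgn σ for
all σ then, coefficient by coefficient, ℓ applied to det over R[x] of the matrix (x_ij·u_ij) is the
permanent per_n(x) (permutation monomials are distinct; det = Σ sgn(σ)∏ M_{σ(i),i}). [difficulty:
provable-now] [MarcusMinc1961, Burgisser2000]
#9 GrassmannUpperBound (support) — the fermionic point s(n) ≤ C(2n,n): in the exterior algebra on
odd generators α_1..α_n, β_1..β_n the commutative subalgebra R generated by the products α_iβ_j is
⊕_k Λ^k⟨α⟩⊗Λ^k⟨β⟩ of dimension Σ_k C(n,k)² = C(2n,n), and with u_{a,b} = α_a β_b one has ∏_i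
α_{σ(i)}β_i = ε_n·sgn(σ)·α_1⋯α_nβ_1⋯β_n for a sign ε_n depending only on n; take ℓ = ε_n·(top
coefficient) (card F1: "the fermionic trick = the apolar algebra of det_n"). [difficulty: M]
[Shafiei2015, Landsberg2017, BrandDellHusfeldt2018]
#9 NoScalarTwist (support) — Pólya–Szegő (1913) / Marcus–Minc: for n ≥ 3 no complex matrix u has ∏_i
u_{σ(i),i} = sgn σ for all σ, i.e. s(n) ≥ 2 (3×3 case: the three even and the three odd transversals
each use every entry once, so the products of the two triples of values agree, 1 = −1; general n by
fixing n−3 points). [difficulty: provable-now] [BrualdiRyser1991, MarcusMinc1961]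
#9 SimulationCost (support) — VH-necessity glue (card F2; HrubesYehudayoff2011 Thm 4.2 in the
commutative case): there is an absolute c such that a commutative realisation of sgn_n of dimension
≤ s yields an arithmetic circuit over ℂ for per_n of size ≤ (n+s+2)^c — run a division-free
determinant (Samuelson–Berkowitz / Mahajan–Vinay, poly(n) ring operations) over R[x] with elements
stored as dim R coordinate polynomials, each ring product costing dim(R)^3 scalar operations, then
apply ℓ. Consequently s p-bounded ⇒ per ∈ VP and s qp-bounded ⇒ per ∈ VQP. [difficulty: M]
[HrubesYehudayoff2011, MahajanVinay1997, Berkowitz1984, Rote2001]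

TWO-LAYER PLAN. Foreseen glued splits (none filed now). SDimUnbounded ⇐ DimTwoExcluded (no
realisation over ℂ² or ℂ[ε]/ε² for n ≥ 5: tdr(per_n) ≥ 3 plus
the dual-number linear-preserver statement) → LocalSocleBound (a LOCAL realising algebra has
nil-index ≥ the junta degree n−1 of sgn, so
truncated polynomial rings ℂ[ε]/ε^k reduce to k-term twisted-determinant sums) → SDimUnbounded
(glue: structure theorem for Artinian
algebras, R = ⊕ local). SDimPerNotQP ⇐ SemisimpleExp (tdr(per_n) ≥ 2^{Ω(n)}: the
secant-of-Birkhoff-toric statement shared with card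
twisted-determinantal-rank) → JunkRigidity (an ideal of colength < 2^{δn} meeting the transversal
span inside ker(sgn) is, after a torus
degeneration à la border apolarity, supported on ≤ 2^{δn} reduced points — "nilpotents buy at most a
polynomial factor over idempotents")
→ SDimPerNotQP. ClassTransfer ⇐ CheapConeSmall (every χ in the cone sgn·F(c_1)·P(c_2..c_k) + bounded
support has s ≤ n^{O(k)},
provable now) → ConeExhaustsVP (VP class functions lie in that cone up to qp closure — the genuinely
conjectural half, comparable to
ImmanantSlice.CuspidalRigidity) → ClassTransfer.

KILL CRITERIA. ClassTransfer refuted by an explicit VP class-function family with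
super-quasi-polynomial s — or, cheaper and just as fatal, by a VP
class-function family whose small realisations would compute permanents (a class-function analogue
of the Pfaffian escape, making the
assembly vacuous) — closes the route `refuted:ClassTransfer`; the witness goes to the negatives
index and to route ImmanantSlice as a test of
CR. SDimPerNotQP refuted (a qp-dimensional commutative algebra faking sgn_n for all n) means per ∈
VQP: close the route AND flag DetQP,
ScaledPencil, PrincipalMinorColouring (their theses die with it). A construction with s(n) =
2^{o(n)} does not refute any item but kills the
2^{Θ(n)} conjecture and beats Ryser — pivot the rationale, keep the items. SDimUnbounded cannot be
refuted without refuting VH. If VH is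
proved elsewhere the assembly is moot; SDimUnbounded/SDimPerNotQP stay meaningful restricted-model
theorems (hand to Literature).

NOT DECOMPOSED YET. The notion itself (definition request commTwistDim below: s as an sInf,
monotonicity in n by fixing a point, sub-multiplicativity under
direct sums, s ≤ tdr, invariance under the torus × S_n × S_n); the Macaulay-dual normal form (s(n) =
least colength of I ⊂ ℂ[u_ij] with
I ∩ T_n ⊆ ker sgn) and handhold (a) of the card (a realising ideal is incomparable with Ann(det_n))
— provable lemmas to ride with
`--supports SDimPerNotQP`; the rung s(n) ≥ 3; the Pfaffian-escape theorem itself ("unrestricted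
transfer ⇒ per ∈ VQP", provable once a
Pfaffian-over-commutative-rings circuit is in tree) — recorded in Why this line, not filed, because
no item depends on it; the affine /
size-m version (m, s) of the invariant (card grenet-grassmann-line; MacMahon over the zeon algebra
gives (poly(n), 2^n)) — a different
route; exact values s(4), s(5) (kit experiment of the card, C4) — useful calibration, not
load-bearing.

CHEAPEST FALSIFIER. For ClassTransfer: exhibit ONE class function outside the cheap cone with d_χ ∈
VP — first test T_n = Σ_σ sgn(σ)·2^{c_2(σ)} x^σ and the
2-cycle-free determinant D_2 = Σ_{c_2(σ)=0} sgn(σ) x^σ (= the t = 0 member of the same pencil): a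
polynomial-size formula for either (literature:
overlapping/path Pfaffian identities, arXiv:2604.28019 on symmetrized determinants; or a kit
interpolation test of #P-hardness on 0/1
matrices) decides it — in VP ⇒ the monomial-algebra count says s(2^{c_2}) is exponential unless
nilpotents are shared across pairs in a way
no construction here achieves, so the crux is in acute danger; VNP-hard ⇒ the crux passes its
sharpest known test. For SDimPerNotQP /
SDimUnbounded: solve the 24 + junk equations for n = 4 over the four 3-dimensional and the
2-dimensional commutative algebras (is s(4) = 3 =
tdr(per_4), or does a local algebra reach 2?). Not run here (hub compute-free; recorded for the
refuter).

NUMBERS. s(1) = s(2) = 1; s(n) ≥ 2 for n ≥ 3 (BrualdiRyser1991 Thm 7.5.1, MarcusMinc1961); s(3) = 2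
(tdr(per_3) = 2 over ℚ(ζ_3), card
twisted-determinantal-rank; Tesler2000 crosscap formula gives the same with Gaussian units);
numerically tdr(per_4) = 3, tdr(per_5) ∈ {7, 8}
(sibling audits) so s(4) ≤ 3, s(5) ≤ 8; s(n) ≤ tdr(per_n) ≤ n^{O(n)} (2n-wise independent signings)
and s(n) ≤ C(2n,n) ≈ 4^n/√(πn)
(Grassmann), the smaller of the two switching at n ≈ 12; cactus length of det_n without junk ≥
½·C(2n,n) (RS11 + Shafiei2015); MacMahon /
zeon point for the AFFINE poly-size variant: dimension 2^n (BrandDellHusfeldt2018 Lemma 14).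
Simulation: L(per_n) ≤ poly(n)·s(n)^3
(HrubesYehudayoff2011 Thm 4.2), so s(n) < 2^{n/3} would beat Ryser. Items at open: 8 (3 cruxes, 4
support, 1 assembly).

DEFINITION REQUESTS. commTwistDim (Literature/Computability/AlgebraicComplexity): for c : Equiv.Perm
(Fin n) → k over a field k, the least d (as sInf over ℕ,
⊤-free since the group algebra quotient / Grassmann witness exists) such that some commutative
k-algebra R with Module.finrank k R = d,
u : Fin n → Fin n → R and ℓ : R →ₗ[k] k satisfy ℓ (∏ i, u (σ i) i) = c σ for all σ; API wanted:
monotone in n (fix a point), ≤ under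
direct sum of patterns (tensor product of algebras), = 1 iff c is a nowhere-vanishing transversal
product pattern, ≤ the number of
Hadamard-twisted determinants (semisimple R), and the eval lemma linking it to `Matrix.det` over
`MvPolynomial _ R` (TwistedDeterminantFormula).
Filed after open with `ledger workitem add --kind definition --notion commTwistDim --for
<SDimPerNotQP>`; all items above inline the
notion, nothing waits on it. Compatible with ImmanantSlice's requested genMatrixPoly (same inlined
GMF sum).

Novelty: Searches (2026-08-15): `lit search --hybrid "permanent determinant commutative algebra nilpotent
coefficients Grassmann"` (15 rows: physics
Grassmann-integral textbooks, Landsberg2017, Brualdi–Ryser — none with coefficient algebras for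
per); `lit search --hybrid "conversion of the
permanent into the determinant Polya problem sign-nonsingular"` (Brualdi–Ryser §7.5 read: Thm 7.5.1
Pólya–Szegő, Marcus–Minc, sign-nonsingular
= r = 1 on sub-supports); `lit search --hybrid "apolar ideal determinant permanent Hilbert function
cactus rank"` (Landsberg2017 §10.1 read:
Thm 10.1.4.1 RS11, apolarity lemma); `lit search --source crossref "division-free algorithms
determinant Pfaffian Rote"` (Rote2001);
`lit frontier ValiantsHypothesis --since 2020` (30 rows; relevant: arXiv:2604.22006
noncommutative-ring circuit lower bounds, arXiv:2604.28019
symmetrized determinant — neither on commutative twisting); `lit galaxy search --star all` for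
"permanent as a determinant over a commutative
ring" (0), "zeon algebra permanent" (0), "Berezin integral" (13, physics), "hafnian" (8, boson
sampling), "Pfaffian orientations" (12, graph
theory volumes); the card's own searches and its audit (MacMahon/zeons BrandDellHusfeldt2018 =
arXiv:1804.09448, Arvind–Srinivasan, Blaser/CHSS, HY11 read there);
`ledger negatives --problem ValiantsHypothesis` (0); all 32 route files of the sub and the sibling
cards twisted-determinantal-rank,
grenet-grassmann-line, and route ImmanantSlice in full.
Nearest prior art found  [refs: 2604.22006, 2604.28019, 1804.09448, Landsberg2017, Rote2001, BrandDellHusfeldt2018, MarcusMinc1961, BrualdiRyser1991, Tesler2000, LoeblMasbaum2011, ArvindSrinivasan2010, HrubesYehudayoff2011, Curticapean2021, RanestadSchreyer2011, Shafiei2015]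

Barriers (technique_class: restricted-model, apolarity, normal-form-transfer): - technique_class: restricted-model, apolarity, normal-form-transfer
- Literature.Barriers.ValiantsHypothesis.NoncommutativeExtensions: the route is the commutative
mirror of HY11 — it never argues in a way that survives noncommutative extension (over
Clifford/matrix algebras of poly dimension sgn IS a product pattern and the model collapses,
ArvindSrinivasan2010); commutativity of R is used essentially (det_R easy, HY Thm 3.4), so the O(dn)
ceiling does not apply.
- Literature.Barriers.ValiantsHypothesis.PartialDerivativesDetPerm: acknowledged and sharpened — a
single catalecticant of det_n + junk can be completed to rank one degree by degree, so X1 cannot be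
a function of flattening ranks; the bet is Hankel consistency across degrees / socle / smoothability
of the realising scheme, which are not rank measures.
- Literature.Barriers.ValiantsHypothesis.RankMethods: same remark; X1 is a statement about one
explicit point (sgn) versus images of multiplication maps of ALL commutative algebras of dimension s
— a cactus-type (scheme) membership, precisely the object Landsberg2017 §10.2 identifies as lying
beyond determinantal (rank) equations; it does not evade the barrier by a rank method, it is forced
past it.
- Literature.Barriers.ValiantsHypothesis.RankLifting: not engaged (no lifted rank measure).
- Literature.Barriers.ValiantsHypothesis.ShiftedPartialsCannotSeparate: not engaged (no shifted
partials, no depth reduction).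
- Literature.Barriers.ValiantsHypothesis.AlgebraicNatu

Novelty grade: new-combination — ROUTE REVIEW (refuter) PASS, ClassTransfer high-risk; new-combination (concur w/ card audit; route deltas — Pfaffian escape + class-function repair — verified; overlap w/ OPEN GrenetZeon is complementary: affine (m,s)-model vs this fixed-support n×n Hadamard-twist model; negatives 0). ELAB: tree fil (refuter refuter-rreview-route-SmoothPoincare4-Tr-ef8906bd-0, 2026-08-15T13:57:31Z; prior: MarcusMinc1961, BrualdiRyser1991 Thm7.5.1, arXiv:1804.09448 (zeons/extensor coding), HrubesYehudayoff2011 Thm3.4/4.2, ArvindSrinivasan2010, Curticapean2021, RanestadSchreyer2011, Shafiei2015, Rote2001, MertensMoore2013, route-ValiantsHypothesis-GrenetZeon)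

History (route lifecycle, newest last):
- 2026-08-23T17:54:13Z · DORMANT — reconciler: no traction for 6.2 d (last activity item-evidence-added at 2026-08-17T13:32:49Z); parked, not closed — `ledger route dormant route-ValiantsHypothes (operator:999:1667163)

sub-problem: ValiantsHypothesis · status: dormant · opened planner-plancard-ValiantsHypothesis-ValiantsH-3e81970d-0 2026-08-15T12:07:04Z · rev 1 · ledger route-ValiantsHypothesis-FermionizationDimension
GENERATED by the gate from the ledger (D-0016/17). Provers cite these decls: `theorem foo : Summit.ValiantsHypothesis.ValiantsHypothesis.Theses.FermionizationDimension.<Decl> := …` in Summits/ValiantsHypothesis/ValiantsHypothesis/Theorems/<Name>.lean.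
-/

namespace Summit.ValiantsHypothesis.ValiantsHypothesis.Theses.FermionizationDimension

open scoped BigOperators Topology Manifold Classical MeasureTheory ProbabilityTheory Matrix InnerProductSpace ComplexConjugate ContinuousMap
open Filter Set Function TopologicalSpace MeasureTheory

attribute [summit_statement] _root_.ValiantsHypothesis

open Literature.PNP

/-- item stmt-ValiantsHypothesis-7286 · crux · rank 2 · closed · proved by Summit.ValiantsHypothesis.ValiantsHypothesis.Theorems.sDimPerNotQP_proof @ 8b41234b531f (prover) · by planner
why it might fail: false only if VNP ⊆ VQP (SimulationCost); the risk is technique: junk (several fat points) fools every single catalecticant, complex twists already give tdr(per_3)=2, tdr(per_4)=3, and no min-over-completions cactus bound exists yet.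
sources: MarcusMinc1961, BrualdiRyser1991, RanestadSchreyer2011, Shafiei2015, IarrobinoKanev1999, BuczynskaBuczynski2021
[crux] the commutative twisting dimension of the permanent is not quasi-polynomially bounded: for
every quasi-polynomially bounded s there is an n such that no commutative ℂ-algebra R with dim R ≤
s(n), u ∈ R^{n×n}, ℓ ∈ R^* satisfy ℓ(∏_i u_{σ(i),i}) = sgn σ for all σ ∈ S_n (card C1, "det_n is
junk-incompressible"; conjectured truth 2^{Θ(n)}, possibly C(2n,n)). [difficulty: open-problem] -/
@[route_item "route-ValiantsHypothesis-FermionizationDimension", crux]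
def SDimPerNotQP : Prop :=
  ∀ s : ℕ → ℕ, Literature.Computability.AlgebraicComplexity.IsQPBounded s → ∃ n : ℕ, ∀ (R : Type) [CommRing R] [Algebra ℂ R] [Module.Finite ℂ R] (u : Fin n → Fin n → R) (ℓ : R →ₗ[ℂ] ℂ), (∀ σ : Equiv.Perm (Fin n), ℓ (∏ i, u (σ i) i) = ((Equiv.Perm.sign σ : ℤ) : ℂ)) → s n < Module.finrank ℂ R

/-- item stmt-ValiantsHypothesis-7287 · crux · rank 3 · open · by planner
why it might fail: a VP class-function family whose cheapness comes from Pfaffian-type or cross-determinant cancellation (suspects: sgn·t^{c_2(σ)}, the 2-cycle-free determinant, D^even = Σ_{all cycles even} sgn x^σ if any is in VP) would have exponential s, exactly as Pf(x_ij x_ji) kills the unrestricted form.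
sources: Curticapean2021, Burgisser2000Immanants, Hartmann1985, MertensMoore2013, Tesler2000, LoeblMasbaum2011
[crux] fermionic normal form on Schur's slice: for every family of class functions χ_n : S_n → ℂ
whose generalized matrix functions d_{χ_n} = Σ_σ χ_n(σ) ∏_i x_{σ(i),i} form a VP family over ℂ,
there is a quasi-polynomially bounded s such that for every n some commutative ℂ-algebra R of
dimension ≤ s(n), u ∈ R^{n×n}, ℓ ∈ R^* realise ℓ(∏_i u_{σ(i),i}) = sgn(σ)·χ_n(σ) ("a polynomial-size
circuit for a class-function amplitude is one determinant over a small commutative world of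
nilpotents"; card (B_s), restricted to class functions). [difficulty: open-problem] -/
@[route_item "route-ValiantsHypothesis-FermionizationDimension", crux]
def ClassTransfer : Prop :=
  ∀ χ : (n : ℕ) → Equiv.Perm (Fin n) → ℂ, (∀ n (σ τ : Equiv.Perm (Fin n)), IsConj σ τ → χ n σ = χ n τ) → Literature.Computability.AlgebraicComplexity.IsVPFamily (fun n => ∑ σ : Equiv.Perm (Fin n), MvPolynomial.C (χ n σ) * ∏ i : Fin n, MvPolynomial.X (σ i, i)) → ∃ s : ℕ → ℕ, Literature.Computability.AlgebraicComplexity.IsQPBounded s ∧ ∀ n : ℕ, ∃ (R : Type) (_ : CommRing R) (_ : Algebra ℂ R) (_ : Module.Finite ℂ R) (u : Fin n → Fin n → R) (ℓ : R →ₗ[ℂ] ℂ), Module.finrank ℂ R ≤ s n ∧ ∀ σ : Equiv.Perm (Fin n), ℓ (∏ i, u (σ i) i) = ((Equiv.Perm.sign σ : ℤ) : ℂ) * χ n σ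

/-- item stmt-ValiantsHypothesis-7288 · crux · rank 4 · closed · proved by Summit.ValiantsHypothesis.ValiantsHypothesis.Theorems.stub_sDimUnbounded (prover) · by planner
why it might fail: false only if per ∈ VP (bounded s + SimulationCost + monotonicity of s in n); the risk is that even dimension 2 resists: tdr(per_n) ≥ 3 is only numerical (n = 4, 5) and linear-preserver arguments over local rings (dual numbers) are untried.
sources: MarcusMinc1961, BrualdiRyser1991, Tesler2000, LoeblMasbaum2011, HrubesYehudayoff2011
[crux] s(n) → ∞: for every s₀ and all large n, no commutative ℂ-algebra of dimension ≤ s₀ realises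
the sign character of S_n multiplicatively (first milestone past Marcus–Minc's s(n) ≥ 2; the first
rung s(n) ≥ 3 for n ≥ 5 is, by the classification of 2-dimensional algebras ℂ², ℂ[ε]/ε², the
conjunction of "no two Hadamard-twisted determinants sum to per_n" and "no dual-number
representation per_n = c·det B(x) + tr(adj B(x)·L(x)) with B, L Hadamard scalings of x").
[difficulty: L] -/
@[route_item "route-ValiantsHypothesis-FermionizationDimension"]
def SDimUnbounded : Prop :=
  ∀ s₀ : ℕ, ∃ n₀ : ℕ, ∀ n : ℕ, n₀ ≤ n → ∀ (R : Type) [CommRing R] [Algebra ℂ R] [Module.Finite ℂ R] (u : Fin n → Fin n → R) (ℓ : R →ₗ[ℂ] ℂ), (∀ σ : Equiv.Perm (Fin n), ℓ (∏ i, u (σ i) i) = ((Equiv.Perm.sign σ : ℤ) : ℂ)) → s₀ < Module.finrank ℂ R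

/-- item stmt-ValiantsHypothesis-7289 · support · rank 9 · closed · proved by Summit.ValiantsHypothesis.Theorems.twistedDeterminantFormula_proof @ d8574088b2c8 (prover) · by planner
sources: MarcusMinc1961, Burgisser2000
[support] semantics of the model: if ℓ(∏_i u_{σ(i),i}) = sgn σ for all σ then, coefficient by
coefficient, ℓ applied to det over R[x] of the matrix (x_ij·u_ij) is the permanent per_n(x)
(permutation monomials are distinct; det = Σ sgn(σ)∏ M_{σ(i),i}). [difficulty: provable-now] -/
@[route_item "route-ValiantsHypothesis-FermionizationDimension"]
def TwistedDeterminantFormula : Prop :=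
  ∀ (n : ℕ) (R : Type) [CommRing R] [Algebra ℂ R] (u : Fin n → Fin n → R) (ℓ : R →ₗ[ℂ] ℂ), (∀ σ : Equiv.Perm (Fin n), ℓ (∏ i, u (σ i) i) = ((Equiv.Perm.sign σ : ℤ) : ℂ)) → ∀ m : (Fin n × Fin n) →₀ ℕ, ℓ (MvPolynomial.coeff m (Matrix.det (Matrix.of fun i j : Fin n => (MvPolynomial.X (i, j) : MvPolynomial (Fin n × Fin n) R) * MvPolynomial.C (u i j)))) = MvPolynomial.coeff m (Literature.Computability.AlgebraicComplexity.perPoly (Fin n) ℂ)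

/-- item stmt-ValiantsHypothesis-7290 · support · rank 9 · closed · proved by Summit.ValiantsHypothesis.ValiantsHypothesis.Theorems.grassmannUpperBound_proof (prover) · by planner
sources: Shafiei2015, Landsberg2017, BrandDellHusfeldt2018
[support] the fermionic point s(n) ≤ C(2n,n): in the exterior algebra on odd generators α_1..α_n,
β_1..β_n the commutative subalgebra R generated by the products α_iβ_j is ⊕_k Λ^k⟨α⟩⊗Λ^k⟨β⟩ of
dimension Σ_k C(n,k)² = C(2n,n), and with u_{a,b} = α_a β_b one has ∏_i α_{σ(i)}β_i =
ε_n·sgn(σ)·α_1⋯α_nβ_1⋯β_n for a sign ε_n depending only on n; take ℓ = ε_n·(top coefficient) (card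
F1: "the fermionic trick = the apolar algebra of det_n"). [difficulty: M] -/
@[route_item "route-ValiantsHypothesis-FermionizationDimension"]
def GrassmannUpperBound : Prop :=
  ∀ n : ℕ, ∃ (R : Type) (_ : CommRing R) (_ : Algebra ℂ R) (_ : Module.Finite ℂ R) (u : Fin n → Fin n → R) (ℓ : R →ₗ[ℂ] ℂ), Module.finrank ℂ R ≤ Nat.centralBinom n ∧ ∀ σ : Equiv.Perm (Fin n), ℓ (∏ i, u (σ i) i) = ((Equiv.Perm.sign σ : ℤ) : ℂ)

/-- item stmt-ValiantsHypothesis-7291 · support · rank 9 · closed · proved by Summit.ValiantsHypothesis.ValiantsHypothesis.Theorems.noScalarTwist_proof (prover) · by planner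
sources: BrualdiRyser1991, MarcusMinc1961
[support] Pólya–Szegő (1913) / Marcus–Minc: for n ≥ 3 no complex matrix u has ∏_i u_{σ(i),i} = sgn σ
for all σ, i.e. s(n) ≥ 2 (3×3 case: the three even and the three odd transversals each use every
entry once, so the products of the two triples of values agree, 1 = −1; general n by fixing n−3
points). [difficulty: provable-now] -/
@[route_item "route-ValiantsHypothesis-FermionizationDimension"]
def NoScalarTwist : Prop :=
  ∀ n : ℕ, 3 ≤ n → ¬ ∃ u : Fin n → Fin n → ℂ, ∀ σ : Equiv.Perm (Fin n), ∏ i, u (σ i) i = ((Equiv.Perm.sign σ : ℤ) : ℂ)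

/-- item stmt-ValiantsHypothesis-7292 · support · rank 9 · closed · proved by Summit.ValiantsHypothesis.Theorems.simulationCost_proof @ 3de250ba37b9 (prover) · by planner
sources: HrubesYehudayoff2011, MahajanVinay1997, Berkowitz1984, Rote2001
[support] VH-necessity glue (card F2; HrubesYehudayoff2011 Thm 4.2 in the commutative case): there
is an absolute c such that a commutative realisation of sgn_n of dimension ≤ s yields an arithmetic
circuit over ℂ for per_n of size ≤ (n+s+2)^c — run a division-free determinant (Samuelson–Berkowitz
/ Mahajan–Vinay, poly(n) ring operations) over R[x] with elements stored as dim R coordinate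
polynomials, each ring product costing dim(R)^3 scalar operations, then apply ℓ. Consequently s
p-bounded ⇒ per ∈ VP and s qp-bounded ⇒ per ∈ VQP. [difficulty: M] -/
@[route_item "route-ValiantsHypothesis-FermionizationDimension"]
def SimulationCost : Prop :=
  ∃ c : ℕ, ∀ (n s : ℕ), (∃ (R : Type) (_ : CommRing R) (_ : Algebra ℂ R) (_ : Module.Finite ℂ R) (u : Fin n → Fin n → R) (ℓ : R →ₗ[ℂ] ℂ), Module.finrank ℂ R ≤ s ∧ ∀ σ : Equiv.Perm (Fin n), ℓ (∏ i, u (σ i) i) = ((Equiv.Perm.sign σ : ℤ) : ℂ)) → Literature.Computability.AlgebraicComplexity.complexity (Literature.Computability.AlgebraicComplexity.perPoly (Fin n) ℂ) ≤ (n + s + 2) ^ c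

/-- item stmt-ValiantsHypothesis-7293 · assembly · rank 1 · closed · proved by Summit.ValiantsHypothesis.Theorems.FermionizationDimension.assembly_proof @ a5885b7f1075 (prover) · by planner
sources: Valiant1979, Burgisser2000, BurgisserClausenShokrollahi1997
[assembly] SDimPerNotQP → ClassTransfer → ValiantsHypothesis (apply ClassTransfer to χ ≡ 1, whose
d_χ is per_n; contradiction with SDimPerNotQP; `isPComputable_perPoly_complex_iff`). -/
@[route_item "route-ValiantsHypothesis-FermionizationDimension"]
def Assembly : Prop :=
  SDimPerNotQP → ClassTransfer → ValiantsHypothesis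

/-! D-0027 §2.1 — DECIDING THEOREM (planner-authored via `route open/edit --closes-file`; by planner-rbadge-ValiantsHypothesis-Fermionizati-4168d108-g2-0 2026-08-15T16:12:42Z):
its hypotheses are this route's items and its conclusion the sub-problem Statement (glue_lint), and it elaborates with this file. -/

@[closes "route-ValiantsHypothesis-FermionizationDimension"] theorem closes (h_SDimPerNotQP : SDimPerNotQP) (h_ClassTransfer : ClassTransfer) :
    _root_.ValiantsHypothesis := by
  show Literature.Computability.AlgebraicComplexity.VP ℂ ≠ Literature.Computability.AlgebraicComplexity.VNP ℂ
  intro hEq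
  -- VP = VNP puts the permanent family in VP (Valiant: PER ∈ VNP; bundling bridge).
  have hVNP := Literature.Computability.AlgebraicComplexity.perFamily_mem_VNP_holds ℂ
  have hVP : Literature.Computability.AlgebraicComplexity.perFamily ℂ ∈
      Literature.Computability.AlgebraicComplexity.VP ℂ := by rw [hEq]; exact hVNP
  have hper : Literature.Computability.AlgebraicComplexity.IsVPFamily
      (fun n => Literature.Computability.AlgebraicComplexity.perPoly (Fin n) ℂ) :=
    (Literature.Computability.AlgebraicComplexity.mem_VP_ofFintype_iff_holds _).1 hVP
  -- The permanent family is the generalized matrix function of the class function χ ≡ 1.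
  have hfun : (fun n => ∑ σ : Equiv.Perm (Fin n),
      MvPolynomial.C ((fun (m : ℕ) (_ : Equiv.Perm (Fin m)) => (1 : ℂ)) n σ) *
        ∏ i : Fin n, MvPolynomial.X (σ i, i)) =
      (fun n => Literature.Computability.AlgebraicComplexity.perPoly (Fin n) ℂ) := by
    funext n
    simp [Literature.Computability.AlgebraicComplexity.perPoly, Matrix.permanent,
      Matrix.mvPolynomialX]
  have hfam : Literature.Computability.AlgebraicComplexity.IsVPFamily
      (fun n => ∑ σ : Equiv.Perm (Fin n),
        MvPolynomial.C ((fun (m : ℕ) (_ : Equiv.Perm (Fin m)) => (1 : ℂ)) n σ) *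
          ∏ i : Fin n, MvPolynomial.X (σ i, i)) := by
    rw [hfun]; exact hper
  -- ClassTransfer at χ ≡ 1: a quasi-polynomially bounded realisation of sgn for every n …
  obtain ⟨s, hs, hreal⟩ :=
    h_ClassTransfer (fun (m : ℕ) (_ : Equiv.Perm (Fin m)) => (1 : ℂ)) (fun _ _ _ _ => rfl) hfam
  -- … contradicting SDimPerNotQP at its witness n.
  obtain ⟨n, hn⟩ := h_SDimPerNotQP s hs
  obtain ⟨R, _, _, _, u, ℓ, hdim, hu⟩ := hreal n
  have hlt : s n < Module.finrank ℂ R := hn R u ℓ (fun σ => by rw [hu σ, mul_one])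
  omega

end Summit.ValiantsHypothesis.ValiantsHypothesis.Theses.FermionizationDimension
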